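/-
Copyright (c) 2026 the pub-hodgecm-mathlib formalisation cell (harness21).  Prover seat hodgecm-mathlib-K2E2-p03 (g0),
Track B «K2-LIT» ∕ h413 (stmt-HodgeConjecture-24833), line K2_E2 «ThetaExhaustionByRigidity», unit ORIENT, socket #18 (OR-2) — FILE 2∕4:
the OUTPUT ADAPTER of the Θ-OCC-GEN pipeline with the value module (holomorphic ∕ antiholomorphic cotangent forms) TRACKED.  2026-09-03.
KERNEL module: THEOREMS ONLY (no definition, no named fact, no `sorry`, no instance, no notation).
-/
import Summits.HodgeConjecture.HodgeConjecture.Theorems.F0P2tThetaOccursInGenNeg          -- ★ Θ-OCC-GEN: GenNeg §1 adapters (coh), (Ta)∕(Tf) transports, pin data `frameD`∕`ιVE`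
import HarnessLib

/-!
# K2_E2 road (h413 = stmt-HodgeConjecture-24833), unit ORIENT, socket #18 (OR-2) — file 2∕4: the ORIENTED OUTPUT ADAPTER of the Θ-OCC-GEN pipeline

Cell `pub/hodgecm-mathlib` (D-0151), Track B (chair K2-lead, dealer K2E2-plan R8 RE-CUT 2026-09-03T21:42Z), socket `Orient.sig_K2E2OrAntiholWitnessOfNeg` (paid in
file 4∕4 `Theorems/K2E2OrAntiholWitnessOfNeg.lean`).  The output adapter of the tree's Θ-OCC-GEN pipeline moves an occurrence clause from the PIN frame of a
packaged CM frame `(F, V)` (`frameD V`, `ιVE V`, values in the crux carriers of `archFactorOf F V`) to the LETTER's frame `(dV, g, ιV)` at any Sylvester frame `T`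
(values in the generic carriers at `(cmArchSection T, cmCompactFactor T)`): (Ta) ★ `F0P2sThetaOccursInArchTransport.exists_linear_frameTransport_from_pin` (an
injective equivariant `Lb` with a `hol ↦ hol`, a `conj hol ↦ conj hol` and a `coh ↦ coh` component) ∘ ★ `occursClause_map_values`, then (Tf) ★
`F0P2sThetaOccursInFrameTransport.thetaOccursInClause_of_frame_change` (generic in the value module).  ★ GenNeg §1 packages this for `cohForms` only
(`thetaOccursInClause_of_pinFrame_archFactorOf_coh`) and ★ p844332 for `hol ↦ coh`; this file lands the two ORIENTED packagings (same proofs, token for token,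
only the value submodule changes):
* `occursClause_antihol_frame_of_archFactorOf_antihol` — (Ta) with the antiholomorphic component.
* `thetaOccursInClause_of_pinFrame_archFactorOf_antihol` — `conj holCotForms (archFactorOf F V)` at `(frameD V, ιVE V)` ↦ `conj holCotForms [T]` at `(dV, g, ιV)`.
* `thetaOccursInClause_of_pinFrame_archFactorOf_hol` — `holCotForms (archFactorOf F V)` ↦ `holCotForms [T]` ((Ta) = ★ `occursClause_holCotForms_frame_of_archFactorOf`).
Consumer: file 3∕4 `Theorems/K2E2ThetaOccursInGenAntihol.lean` (Cases B ∕ A ∕ D of Θ-OCC-GEN with oriented values). [cite: BorelJacquet1979, §4.1, §4.2]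

HONEST LABEL: HC_CM is proved only modulo the 7 printed citations (2 remaining named inputs: hLiu418 = stmt-HodgeConjecture-24832,
h413 = stmt-HodgeConjecture-24833) until rung 0 closes; this file is a `--supports stmt-HodgeConjecture-24833` helper and discharges no printed citation by
itself — kernel glue over ★ rows.

## References
* [Liu2021] Y. Liu, *Fourier–Jacobi cycles and arithmetic relative trace formula*, Camb. J. Math. 9 (2021) = arXiv:2102.11518: proof of Prop. 4.13
  («Conversely» l. 2145–2149); Def. 4.11–4.12; App. D §D.1 Steps 1–3, Lem. D.1 (2) (l. 5231), Lem. D.2 (2) p. 127.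
* [GelbartRogawski1991] S. Gelbart, J. Rogawski, Invent. Math. 105 (1991), §3.1 Prop. 3.1.1 p. 455; Remark p. 457.
* [BorelWallach2000] A. Borel, N. Wallach, 2nd ed. (2000), VII 2.10.  [BorelJacquet1979] A. Borel, H. Jacquet, PSPM 33.1 (1979), §4.1, §4.2.
* [PlatonovRapinchuk1994] V. Platonov, A. Rapinchuk (1994), §2.3, §5.1.
-/

set_option autoImplicit false
-- the mandated namespace repeats the single-problem summit's segment (`HodgeConjecture.HodgeConjecture`)
set_option linter.dupNamespace false

noncomputable section

namespace Summit.HodgeConjecture.HodgeConjecture.Cruxes.H413.K2E2ThetaOccursInOrientedAdapter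

section Adapter


open MulAction NumberField NumberField.InfinitePlace NumberField.mixedEmbedding IsDedekindDomain
open scoped SchwartzMap TensorProduct Classical Matrix ComplexOrder
open Literature.NumberTheory.Automorphic Literature.NumberTheory.Automorphic.UnitaryGroup Literature.NumberTheory.Weil1964
open Literature.NumberTheory.Automorphic.UnitaryGroup.CotangentForms
open Literature.NumberTheory.Automorphic.IdeleClassGroup
open Literature.Geometry.ComplexHyperbolic.BallModel (U21 x₀)
open Literature.AlgebraicGeometry.ShimuraVarieties
open Literature.AlgebraicGeometry.Motives (CMType)
open Literature.NumberTheory.GelbartRogawski1991 Literature.NumberTheory.GelbartRogawski1991.UnitaryDualPair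
open Literature.NumberTheory.GelbartRogawski1991.UnitaryDualPair.WeilCoinv (commute_comp_inl_comp_inr finPairToAdelic finPairRep)
open Literature.NumberTheory.Automorphic.Liu2021 Literature.NumberTheory.Automorphic.Liu2021.Def411WeilCarriers Literature.NumberTheory.Automorphic.Liu2021.Def411WeilCarriersDoubling
open Literature.NumberTheory.GaloisRepresentations (HeckeCharacter)
open Literature.RepresentationTheory Literature.RepresentationTheory.Liu2021
open Literature.RepresentationTheory.HarrisKudlaSweet1996 (IsSplittingChar)
open HodgeCM HodgeCM.Adelic HodgeCM.PerL34 HodgeCM.Model HodgeCM.Model.ThetaSpace HodgeCM.Model.ArchSideTerm HodgeCM.Model.ThetaAdelicSide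
open HodgeCM.Model.ThetaDistFin HodgeCM.Model.HypCensus HodgeCM.Model.LiuIndex HodgeCM.Model.TowerCarrier
open HodgeCM.Model.SupplyResidual.WeilPairData (charInv)
open Literature.Analysis.SegalBargmann (binvPi)
open Literature.AlgebraicGeometry.ShimuraVarieties (BallForms.isPullbackCocycle_cotangentCocycle BallForms.expP)
open Literature.AlgebraicGeometry.Liu2021 (IsAdmissibleElement isAdmissibleElement_conj_neg_iff)
open Literature.NumberTheory.ComplexMultiplication.CMTypeOps (bar mem_bar_iff coe_bar_eq_setOf_conjugate_mem)
open Summit.HodgeConjecture.CorCM Summit.HodgeConjecture.CorCM.Model Summit.HodgeConjecture.CorCM.Transposition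
open Summit.HodgeConjecture.CorCM.Transposition.OmegaChiSplitting (hsChiD)
open Summit.HodgeConjecture.HodgeConjecture.Cruxes.H413
open Summit.HodgeConjecture.HodgeConjecture.Cruxes.H413.ThetaJunction
open Summit.HodgeConjecture.HodgeConjecture.Cruxes.H413.CohFormsCarriers
open Summit.HodgeConjecture.HodgeConjecture.Cruxes.H413.CuspCot Summit.HodgeConjecture.HodgeConjecture.Cruxes.H413.ThetaDistAtLine Summit.HodgeConjecture.HodgeConjecture.Cruxes.H413.AdmissibleLine
open Summit.HodgeConjecture.HodgeConjecture.Cruxes.H413.F0P2OccGenCotangentOfOccursIn (cmFieldOf hermSpace3Of)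
open Summit.HodgeConjecture.HodgeConjecture.Cruxes.H413.F0P3HolProjectionReduction (four_le_finrank_of_two_le)
open Summit.HodgeConjecture.HodgeConjecture.Cruxes.H413.F0P2sThetaOccursInFrameTransport
open Summit.HodgeConjecture.HodgeConjecture.Cruxes.H413.F0P2sThetaOccursInArchTransport
open Summit.HodgeConjecture.HodgeConjecture.Cruxes.H413.F0P2sThetaOccursInGenOriented
open Literature.NumberTheory.Automorphic.UnitaryGroup.CotangentForms
open Literature.Geometry.ComplexHyperbolic NumberField.InfinitePlace
open Literature.Geometry.ComplexHyperbolic.BallModel (U21 x₀ conjU21 mat)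

open Summit.HodgeConjecture.HodgeConjecture.Cruxes.H413.F0P2tThetaOccursInGenNeg
open Literature.NumberTheory.ComplexMultiplication.CMTypeOps (conjugate_mem_iff_notMem)


/-! ## The output adapter with the value module tracked: antiholomorphic ∕ holomorphic values at the pin frame ↦ the same at the letter's frame -/


variable (F : HodgeCM.CMField) {ι₁ : F →+* ℂ} (V : HodgeCM.HermSpace3 F ι₁) (T : GL (Fin 3) ℂ)
  (hT : (T : Matrix (Fin 3) (Fin 3) ℂ)ᴴ * (HodgeCM.HermSpace3.Hm V).map ι₁ * (T : Matrix (Fin 3) (Fin 3) ℂ) = Literature.Geometry.ComplexHyperbolic.BallModel.J)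
  {n' : ℕ} (e₁ : Fin 3 × Fin 1 ≃ Fin n')
  (dV : Fin 3 → HodgeCM.CMField.K F) (hdV : ∀ i, IsCMField.complexConj (HodgeCM.CMField.K F) (dV i) = dV i) (hdV0 : ∀ i, dV i ≠ 0)
  (g : GL (Fin 3) (HodgeCM.CMField.K F))
  (hg : ((g : Matrix (Fin 3) (Fin 3) (HodgeCM.CMField.K F)).map (cmConjRingHom (HodgeCM.CMField.K F)))ᵀ * HodgeCM.HermSpace3.Hm V *
      (g : Matrix (Fin 3) (Fin 3) (HodgeCM.CMField.K F)) = Matrix.diagonal dV)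
  (ιV : finAdelic (↥(maximalRealSubfield (HodgeCM.CMField.K F))) (HodgeCM.CMField.K F) (IsCMField.complexConj (HodgeCM.CMField.K F)) 3
      (HodgeCM.HermSpace3.Hm V) →*
    finAdelic (↥(maximalRealSubfield (HodgeCM.CMField.K F))) (HodgeCM.CMField.K F) (IsCMField.complexConj (HodgeCM.CMField.K F)) 3
      (Matrix.diagonal dV))
  (hιV : ∀ k, ((ιV k : finAdelic (↥(maximalRealSubfield (HodgeCM.CMField.K F))) (HodgeCM.CMField.K F)
        (IsCMField.complexConj (HodgeCM.CMField.K F)) 3 (Matrix.diagonal dV)) : GL (Fin 3) (FiniteAdeleRing (𝓞 (HodgeCM.CMField.K F)) (HodgeCM.CMField.K F))) =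
      (toFinAdeleGL (HodgeCM.CMField.K F) 3 g)⁻¹ * (k : GL (Fin 3) (FiniteAdeleRing (𝓞 (HodgeCM.CMField.K F)) (HodgeCM.CMField.K F))) *
        toFinAdeleGL (HodgeCM.CMField.K F) 3 g)
  (μ : Literature.NumberTheory.Automorphic.IdeleClassGroup (HodgeCM.CMField.K F) →ₜ* Circle) (hμ : IsConjugateSymplectic (HodgeCM.CMField.K F) μ)
  (a : (↥(maximalRealSubfield (HodgeCM.CMField.K F)))ˣ)
  (χ : Chi (↥(maximalRealSubfield (HodgeCM.CMField.K F))) (HodgeCM.CMField.K F) (IsCMField.complexConj (HodgeCM.CMField.K F)))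

include hT in
/-- **(Ta), antiholomorphic input and output**: an occurrence with values in `conj holCotForms (archFactorOf F V)` gives, for every Sylvester frame `T` of
`Hm V` at `ι₁`, an occurrence with values in `conj holCotForms [cmArchSection T, cmCompactFactor T]` — ★ `exists_linear_frameTransport_from_pin` (its antiholomorphic
component) ∘ ★ `occursClause_map_values`. [cite: BorelJacquet1979, §4.1, §4.2] [cite: BorelWallach2000, VII 2.10] -/
theorem occursClause_antihol_frame_of_archFactorOf_antihol {W : Type} [AddCommGroup W] [Module ℂ W]
    (σ : Representation ℂ ↥(HodgeCM.HermSpace3.adelicFin V) W)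
    (h : ∃ θ : W →ₗ[ℂ] ((CohFormsCarriers.adelicDatum F V).Adelic → (Fin 2 → ℂ)),
      θ ≠ 0 ∧ (∀ w, θ w ∈ (CohFormsCarriers.holCotForms (CohFormsCarriers.archFactorOf F V)).map (CohFormsCarriers.conjFun F V)) ∧
        ∀ (g : ↥(HodgeCM.HermSpace3.adelicFin V)) (w : W), θ (σ g w) = CohFormsCarriers.rightRep F V g (θ w)) :
    ∃ θ : W →ₗ[ℂ] ((CohFormsCarriers.adelicDatum F V).Adelic → (Fin 2 → ℂ)),
      θ ≠ 0 ∧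
        (∀ w, θ w ∈ (CotangentForms.holCotForms (↥(maximalRealSubfield (HodgeCM.CMField.K F))) (HodgeCM.CMField.K F) (IsCMField.complexConj (HodgeCM.CMField.K F)) 3
          (HodgeCM.HermSpace3.Hm V) (cmArchSection (HodgeCM.CMField.K F) ι₁ (HodgeCM.HermSpace3.Hm V) T hT)
          (cmCompactFactor (HodgeCM.CMField.K F) ι₁ (HodgeCM.HermSpace3.Hm V) T hT)).map
          (CotangentForms.conjFun (↥(maximalRealSubfield (HodgeCM.CMField.K F))) (HodgeCM.CMField.K F) (IsCMField.complexConj (HodgeCM.CMField.K F)) 3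
            (HodgeCM.HermSpace3.Hm V))) ∧
        ∀ (g : ↥(HodgeCM.HermSpace3.adelicFin V)) (w : W),
          θ (σ g w) = fun x => θ w (x * CohFormsCarriers.finToAdelic F V g) := by
  obtain ⟨Lb, hinj, hcomm, -, hanti, -⟩ := exists_linear_frameTransport_from_pin F V T hT
  exact occursClause_map_values F V σ _ _ Lb hinj hcomm hanti h


include hT hg hιV in
set_option synthInstance.maxHeartbeats 400000 in
set_option maxHeartbeats 4000000 in
/-- **THE OUTPUT ADAPTER, antiholomorphic values** — ★ GenNeg `thetaOccursInClause_of_pinFrame_archFactorOf_coh` with `conj holCotForms` in place of `cohForms` on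
both sides: (Ta) `occursClause_antihol_frame_of_archFactorOf_antihol` then (Tf) ★ `thetaOccursInClause_of_frame_change` (generic in the value module). [cite: Liu2021, Prop. 4.13 («Conversely» l. 2145–2149); Def. 4.11 (l. 2092–2096)] [cite: BorelJacquet1979, §4.1, §4.2]
[cite: PlatonovRapinchuk1994, §2.3, §5.1] -/
theorem thetaOccursInClause_of_pinFrame_archFactorOf_antihol
    (hE : ∃ θ : omegaAtLine (↥(maximalRealSubfield (HodgeCM.CMField.K F))) (HodgeCM.CMField.K F) (IsCMField.complexConj (HodgeCM.CMField.K F)) 3 e₁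
          (Matrix.diagonal (frameD V)) (complexConj_imagUnit (HodgeCM.CMField.K F)) (imagUnit_ne_zero (HodgeCM.CMField.K F))
          (imagUnit_mul_self (HodgeCM.CMField.K F)) (realDiagonal_isSymm (HodgeCM.CMField.K F) (frameD V) (frameD_real V))
          (isUnit_det_realDiagonal (HodgeCM.CMField.K F) (frameD V) (frameD_real V) (frameD_ne V))
          (realDiagonal_map (HodgeCM.CMField.K F) (frameD V) (frameD_real V)).symm
          (fun b => isCompatible_chiSplittingLine (HodgeCM.CMField.K F) e₁ (frameD V) (frameD_real V) (frameD_ne V)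
            (toHeckeCharacter (HodgeCM.CMField.K F) μ) (isUnitary_toHeckeCharacter (HodgeCM.CMField.K F) μ)
            ((isOscillatorChar_toHeckeCharacter_iff μ).mpr hμ)
            (TW (↥(maximalRealSubfield (HodgeCM.CMField.K F))) b) (isSymm_TW (↥(maximalRealSubfield (HodgeCM.CMField.K F))) b)
            (isUnit_det_TW (↥(maximalRealSubfield (HodgeCM.CMField.K F))) b) (JW (↥(maximalRealSubfield (HodgeCM.CMField.K F))) (HodgeCM.CMField.K F) b)
            (JW_eq (↥(maximalRealSubfield (HodgeCM.CMField.K F))) (HodgeCM.CMField.K F) b)) a χ →ₗ[ℂ]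
        ((CohFormsCarriers.adelicDatum F V).Adelic → (Fin 2 → ℂ)),
      θ ≠ 0 ∧ (∀ w, θ w ∈ (CohFormsCarriers.holCotForms (CohFormsCarriers.archFactorOf F V)).map (CohFormsCarriers.conjFun F V)) ∧
        ∀ (k : ↥(HodgeCM.HermSpace3.adelicFin V)) (w),
          θ (rhoAtLine (↥(maximalRealSubfield (HodgeCM.CMField.K F))) (HodgeCM.CMField.K F) (IsCMField.complexConj (HodgeCM.CMField.K F)) 3 e₁
              (Matrix.diagonal (frameD V)) (complexConj_imagUnit (HodgeCM.CMField.K F)) (imagUnit_ne_zero (HodgeCM.CMField.K F))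
              (imagUnit_mul_self (HodgeCM.CMField.K F)) (realDiagonal_isSymm (HodgeCM.CMField.K F) (frameD V) (frameD_real V))
              (isUnit_det_realDiagonal (HodgeCM.CMField.K F) (frameD V) (frameD_real V) (frameD_ne V))
              (realDiagonal_map (HodgeCM.CMField.K F) (frameD V) (frameD_real V)).symm
              (fun b => isCompatible_chiSplittingLine (HodgeCM.CMField.K F) e₁ (frameD V) (frameD_real V) (frameD_ne V)
                (toHeckeCharacter (HodgeCM.CMField.K F) μ) (isUnitary_toHeckeCharacter (HodgeCM.CMField.K F) μ)
                ((isOscillatorChar_toHeckeCharacter_iff μ).mpr hμ)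
                (TW (↥(maximalRealSubfield (HodgeCM.CMField.K F))) b) (isSymm_TW (↥(maximalRealSubfield (HodgeCM.CMField.K F))) b)
                (isUnit_det_TW (↥(maximalRealSubfield (HodgeCM.CMField.K F))) b) (JW (↥(maximalRealSubfield (HodgeCM.CMField.K F))) (HodgeCM.CMField.K F) b)
                (JW_eq (↥(maximalRealSubfield (HodgeCM.CMField.K F))) (HodgeCM.CMField.K F) b)) (ιVE V) a χ k w) =
            CohFormsCarriers.rightRep F V k (θ w)) :
    ∃ θ : omegaAtLine (↥(maximalRealSubfield (HodgeCM.CMField.K F))) (HodgeCM.CMField.K F) (IsCMField.complexConj (HodgeCM.CMField.K F)) 3 e₁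
          (Matrix.diagonal dV) (complexConj_imagUnit (HodgeCM.CMField.K F)) (imagUnit_ne_zero (HodgeCM.CMField.K F))
          (imagUnit_mul_self (HodgeCM.CMField.K F)) (realDiagonal_isSymm (HodgeCM.CMField.K F) dV hdV)
          (isUnit_det_realDiagonal (HodgeCM.CMField.K F) dV hdV hdV0) (realDiagonal_map (HodgeCM.CMField.K F) dV hdV).symm
          (fun b => isCompatible_chiSplittingLine (HodgeCM.CMField.K F) e₁ dV hdV hdV0
            (toHeckeCharacter (HodgeCM.CMField.K F) μ) (isUnitary_toHeckeCharacter (HodgeCM.CMField.K F) μ)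
            ((isOscillatorChar_toHeckeCharacter_iff μ).mpr hμ)
            (TW (↥(maximalRealSubfield (HodgeCM.CMField.K F))) b) (isSymm_TW (↥(maximalRealSubfield (HodgeCM.CMField.K F))) b)
            (isUnit_det_TW (↥(maximalRealSubfield (HodgeCM.CMField.K F))) b) (JW (↥(maximalRealSubfield (HodgeCM.CMField.K F))) (HodgeCM.CMField.K F) b)
            (JW_eq (↥(maximalRealSubfield (HodgeCM.CMField.K F))) (HodgeCM.CMField.K F) b)) a χ →ₗ[ℂ]
        ((CohFormsCarriers.adelicDatum F V).Adelic → (Fin 2 → ℂ)),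
      θ ≠ 0 ∧
        (∀ w, θ w ∈ (CotangentForms.holCotForms (↥(maximalRealSubfield (HodgeCM.CMField.K F))) (HodgeCM.CMField.K F) (IsCMField.complexConj (HodgeCM.CMField.K F)) 3
          (HodgeCM.HermSpace3.Hm V) (cmArchSection (HodgeCM.CMField.K F) ι₁ (HodgeCM.HermSpace3.Hm V) T hT)
          (cmCompactFactor (HodgeCM.CMField.K F) ι₁ (HodgeCM.HermSpace3.Hm V) T hT)).map
          (CotangentForms.conjFun (↥(maximalRealSubfield (HodgeCM.CMField.K F))) (HodgeCM.CMField.K F) (IsCMField.complexConj (HodgeCM.CMField.K F)) 3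
            (HodgeCM.HermSpace3.Hm V))) ∧
        ∀ (k : ↥(HodgeCM.HermSpace3.adelicFin V)) (w),
          θ (rhoAtLine (↥(maximalRealSubfield (HodgeCM.CMField.K F))) (HodgeCM.CMField.K F) (IsCMField.complexConj (HodgeCM.CMField.K F)) 3 e₁
              (Matrix.diagonal dV) (complexConj_imagUnit (HodgeCM.CMField.K F)) (imagUnit_ne_zero (HodgeCM.CMField.K F))
              (imagUnit_mul_self (HodgeCM.CMField.K F)) (realDiagonal_isSymm (HodgeCM.CMField.K F) dV hdV)
              (isUnit_det_realDiagonal (HodgeCM.CMField.K F) dV hdV hdV0) (realDiagonal_map (HodgeCM.CMField.K F) dV hdV).symm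
              (fun b => isCompatible_chiSplittingLine (HodgeCM.CMField.K F) e₁ dV hdV hdV0
                (toHeckeCharacter (HodgeCM.CMField.K F) μ) (isUnitary_toHeckeCharacter (HodgeCM.CMField.K F) μ)
                ((isOscillatorChar_toHeckeCharacter_iff μ).mpr hμ)
                (TW (↥(maximalRealSubfield (HodgeCM.CMField.K F))) b) (isSymm_TW (↥(maximalRealSubfield (HodgeCM.CMField.K F))) b)
                (isUnit_det_TW (↥(maximalRealSubfield (HodgeCM.CMField.K F))) b) (JW (↥(maximalRealSubfield (HodgeCM.CMField.K F))) (HodgeCM.CMField.K F) b)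
                (JW_eq (↥(maximalRealSubfield (HodgeCM.CMField.K F))) (HodgeCM.CMField.K F) b)) ιV a χ k w) =
            fun x => θ w (x * finAdelicToAdelic (↥(maximalRealSubfield (HodgeCM.CMField.K F))) (HodgeCM.CMField.K F)
              (IsCMField.complexConj (HodgeCM.CMField.K F)) 3 (HodgeCM.HermSpace3.Hm V) k) := by
  have h1 := occursClause_antihol_frame_of_archFactorOf_antihol F V T hT _ hE
  exact thetaOccursInClause_of_frame_change (HodgeCM.CMField.K F) 3 (HodgeCM.HermSpace3.Hm V) e₁ dV hdV hdV0 g hg ιV hιV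
    (frameD V) (frameD_real V) (frameD_ne V) (frameG V) (frame_congr V) (ιVE V)
    (fun k => coe_finFrameCongr (HodgeCM.CMField.K F) (HodgeCM.HermSpace3.Hm V) (frameG V) (frameD V) (frame_congr V) k) μ hμ a χ _ h1


include hT hg hιV in
set_option synthInstance.maxHeartbeats 400000 in
set_option maxHeartbeats 4000000 in
/-- **THE OUTPUT ADAPTER, holomorphic values** — ★ p844332 `thetaOccursInClause_of_pinFrame_archFactorOf` with `holCotForms` KEPT in the conclusion:
(Ta) ★ `F0P2sThetaOccursInArchTransport.occursClause_holCotForms_frame_of_archFactorOf` then (Tf) ★ `thetaOccursInClause_of_frame_change` (generic in the value module). [cite: Liu2021, Prop. 4.13 («Conversely» l. 2145–2149); Def. 4.11 (l. 2092–2096)] [cite: BorelJacquet1979, §4.1, §4.2]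
[cite: PlatonovRapinchuk1994, §2.3, §5.1] -/
theorem thetaOccursInClause_of_pinFrame_archFactorOf_hol
    (hE : ∃ θ : omegaAtLine (↥(maximalRealSubfield (HodgeCM.CMField.K F))) (HodgeCM.CMField.K F) (IsCMField.complexConj (HodgeCM.CMField.K F)) 3 e₁
          (Matrix.diagonal (frameD V)) (complexConj_imagUnit (HodgeCM.CMField.K F)) (imagUnit_ne_zero (HodgeCM.CMField.K F))
          (imagUnit_mul_self (HodgeCM.CMField.K F)) (realDiagonal_isSymm (HodgeCM.CMField.K F) (frameD V) (frameD_real V))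
          (isUnit_det_realDiagonal (HodgeCM.CMField.K F) (frameD V) (frameD_real V) (frameD_ne V))
          (realDiagonal_map (HodgeCM.CMField.K F) (frameD V) (frameD_real V)).symm
          (fun b => isCompatible_chiSplittingLine (HodgeCM.CMField.K F) e₁ (frameD V) (frameD_real V) (frameD_ne V)
            (toHeckeCharacter (HodgeCM.CMField.K F) μ) (isUnitary_toHeckeCharacter (HodgeCM.CMField.K F) μ)
            ((isOscillatorChar_toHeckeCharacter_iff μ).mpr hμ)
            (TW (↥(maximalRealSubfield (HodgeCM.CMField.K F))) b) (isSymm_TW (↥(maximalRealSubfield (HodgeCM.CMField.K F))) b)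
            (isUnit_det_TW (↥(maximalRealSubfield (HodgeCM.CMField.K F))) b) (JW (↥(maximalRealSubfield (HodgeCM.CMField.K F))) (HodgeCM.CMField.K F) b)
            (JW_eq (↥(maximalRealSubfield (HodgeCM.CMField.K F))) (HodgeCM.CMField.K F) b)) a χ →ₗ[ℂ]
        ((CohFormsCarriers.adelicDatum F V).Adelic → (Fin 2 → ℂ)),
      θ ≠ 0 ∧ (∀ w, θ w ∈ CohFormsCarriers.holCotForms (CohFormsCarriers.archFactorOf F V)) ∧
        ∀ (k : ↥(HodgeCM.HermSpace3.adelicFin V)) (w),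
          θ (rhoAtLine (↥(maximalRealSubfield (HodgeCM.CMField.K F))) (HodgeCM.CMField.K F) (IsCMField.complexConj (HodgeCM.CMField.K F)) 3 e₁
              (Matrix.diagonal (frameD V)) (complexConj_imagUnit (HodgeCM.CMField.K F)) (imagUnit_ne_zero (HodgeCM.CMField.K F))
              (imagUnit_mul_self (HodgeCM.CMField.K F)) (realDiagonal_isSymm (HodgeCM.CMField.K F) (frameD V) (frameD_real V))
              (isUnit_det_realDiagonal (HodgeCM.CMField.K F) (frameD V) (frameD_real V) (frameD_ne V))
              (realDiagonal_map (HodgeCM.CMField.K F) (frameD V) (frameD_real V)).symm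
              (fun b => isCompatible_chiSplittingLine (HodgeCM.CMField.K F) e₁ (frameD V) (frameD_real V) (frameD_ne V)
                (toHeckeCharacter (HodgeCM.CMField.K F) μ) (isUnitary_toHeckeCharacter (HodgeCM.CMField.K F) μ)
                ((isOscillatorChar_toHeckeCharacter_iff μ).mpr hμ)
                (TW (↥(maximalRealSubfield (HodgeCM.CMField.K F))) b) (isSymm_TW (↥(maximalRealSubfield (HodgeCM.CMField.K F))) b)
                (isUnit_det_TW (↥(maximalRealSubfield (HodgeCM.CMField.K F))) b) (JW (↥(maximalRealSubfield (HodgeCM.CMField.K F))) (HodgeCM.CMField.K F) b)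
                (JW_eq (↥(maximalRealSubfield (HodgeCM.CMField.K F))) (HodgeCM.CMField.K F) b)) (ιVE V) a χ k w) =
            CohFormsCarriers.rightRep F V k (θ w)) :
    ∃ θ : omegaAtLine (↥(maximalRealSubfield (HodgeCM.CMField.K F))) (HodgeCM.CMField.K F) (IsCMField.complexConj (HodgeCM.CMField.K F)) 3 e₁
          (Matrix.diagonal dV) (complexConj_imagUnit (HodgeCM.CMField.K F)) (imagUnit_ne_zero (HodgeCM.CMField.K F))
          (imagUnit_mul_self (HodgeCM.CMField.K F)) (realDiagonal_isSymm (HodgeCM.CMField.K F) dV hdV)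
          (isUnit_det_realDiagonal (HodgeCM.CMField.K F) dV hdV hdV0) (realDiagonal_map (HodgeCM.CMField.K F) dV hdV).symm
          (fun b => isCompatible_chiSplittingLine (HodgeCM.CMField.K F) e₁ dV hdV hdV0
            (toHeckeCharacter (HodgeCM.CMField.K F) μ) (isUnitary_toHeckeCharacter (HodgeCM.CMField.K F) μ)
            ((isOscillatorChar_toHeckeCharacter_iff μ).mpr hμ)
            (TW (↥(maximalRealSubfield (HodgeCM.CMField.K F))) b) (isSymm_TW (↥(maximalRealSubfield (HodgeCM.CMField.K F))) b)
            (isUnit_det_TW (↥(maximalRealSubfield (HodgeCM.CMField.K F))) b) (JW (↥(maximalRealSubfield (HodgeCM.CMField.K F))) (HodgeCM.CMField.K F) b)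
            (JW_eq (↥(maximalRealSubfield (HodgeCM.CMField.K F))) (HodgeCM.CMField.K F) b)) a χ →ₗ[ℂ]
        ((CohFormsCarriers.adelicDatum F V).Adelic → (Fin 2 → ℂ)),
      θ ≠ 0 ∧
        (∀ w, θ w ∈ CotangentForms.holCotForms (↥(maximalRealSubfield (HodgeCM.CMField.K F))) (HodgeCM.CMField.K F) (IsCMField.complexConj (HodgeCM.CMField.K F)) 3
          (HodgeCM.HermSpace3.Hm V) (cmArchSection (HodgeCM.CMField.K F) ι₁ (HodgeCM.HermSpace3.Hm V) T hT)
          (cmCompactFactor (HodgeCM.CMField.K F) ι₁ (HodgeCM.HermSpace3.Hm V) T hT)) ∧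
        ∀ (k : ↥(HodgeCM.HermSpace3.adelicFin V)) (w),
          θ (rhoAtLine (↥(maximalRealSubfield (HodgeCM.CMField.K F))) (HodgeCM.CMField.K F) (IsCMField.complexConj (HodgeCM.CMField.K F)) 3 e₁
              (Matrix.diagonal dV) (complexConj_imagUnit (HodgeCM.CMField.K F)) (imagUnit_ne_zero (HodgeCM.CMField.K F))
              (imagUnit_mul_self (HodgeCM.CMField.K F)) (realDiagonal_isSymm (HodgeCM.CMField.K F) dV hdV)
              (isUnit_det_realDiagonal (HodgeCM.CMField.K F) dV hdV hdV0) (realDiagonal_map (HodgeCM.CMField.K F) dV hdV).symm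
              (fun b => isCompatible_chiSplittingLine (HodgeCM.CMField.K F) e₁ dV hdV hdV0
                (toHeckeCharacter (HodgeCM.CMField.K F) μ) (isUnitary_toHeckeCharacter (HodgeCM.CMField.K F) μ)
                ((isOscillatorChar_toHeckeCharacter_iff μ).mpr hμ)
                (TW (↥(maximalRealSubfield (HodgeCM.CMField.K F))) b) (isSymm_TW (↥(maximalRealSubfield (HodgeCM.CMField.K F))) b)
                (isUnit_det_TW (↥(maximalRealSubfield (HodgeCM.CMField.K F))) b) (JW (↥(maximalRealSubfield (HodgeCM.CMField.K F))) (HodgeCM.CMField.K F) b)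
                (JW_eq (↥(maximalRealSubfield (HodgeCM.CMField.K F))) (HodgeCM.CMField.K F) b)) ιV a χ k w) =
            fun x => θ w (x * finAdelicToAdelic (↥(maximalRealSubfield (HodgeCM.CMField.K F))) (HodgeCM.CMField.K F)
              (IsCMField.complexConj (HodgeCM.CMField.K F)) 3 (HodgeCM.HermSpace3.Hm V) k) := by
  have h1 := occursClause_holCotForms_frame_of_archFactorOf F V T hT _ hE
  exact thetaOccursInClause_of_frame_change (HodgeCM.CMField.K F) 3 (HodgeCM.HermSpace3.Hm V) e₁ dV hdV hdV0 g hg ιV hιV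
    (frameD V) (frameD_real V) (frameD_ne V) (frameG V) (frame_congr V) (ιVE V)
    (fun k => coe_finFrameCongr (HodgeCM.CMField.K F) (HodgeCM.HermSpace3.Hm V) (frameG V) (frameD V) (frame_congr V) k) μ hμ a χ _ h1


end Adapter

end Summit.HodgeConjecture.HodgeConjecture.Cruxes.H413.K2E2ThetaOccursInOrientedAdapter

end
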